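import Summits.QuantumFields.BalabanUV.Beta.GAN24.VHWordsZeroCell

/-!
# `BalabanUV.Beta.GAN24.VHWordsZeroVhSAt` — binder row G-an2-4 ∕ (CONV-C), W-slot CT-W, conservation law (C)∕(C)sym, step (L3) of this lineage's note
# `HOME/b2b-balaban-gan24-formalise-leaf-04/g65/CSYM-LEVEL0-KERNEL-BLUEPRINT.md` §6: **THE BORDER-TABLE HYPOTHESES OF `VHWordsZeroLattice ∕ VHWordsZeroBorder ∕ VHWordsZeroCell`
# DISCHARGED FOR an1's ROOTED BORDER TABLE `S^VH = cVH • vhSAt ρ`** — a local stencil family (`locStencil_vhSAt`), NO ff block and multiplier legs on the coarse lattice (node 7a's packer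
# `packVH`), block-covariant (`vhSAt_translate`) — and the SIX `S^VH` SECTOR WORDS of the dressed source's two exchange words stated for it by name

NOT IN PRINT; OUR BOOKKEEPING ([folklore] instantiation BY NAME of this lineage's GAN24 files 24 ∕ 26 ∕ 27 at an1's `AveragingHessianKernelsRooted.vhSAt ∕ locStencil_vhSAt ∕ vhSAt_translate` and
`AveragingHessianKernels.packVH_*`; G-an2-4 formalisation swarm, leaf prover `b2b-balaban-gan24-formalise-leaf-04`, gen 66).  HONEST FRAMING (cell contract, verbatim): «discharging `BetaPertH`
makes Bałaban's UV stability UNCONDITIONAL — a real constructive-QFT result; it is NOT the continuum limit and NOT the Clay problem.»  HONEST DEPENDENCY (verbatim): «continuum YM on T⁴ ⇐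
BetaPertH ∧ nine spine estimates (0/9 proved); BetaPertH ⇐ (D1) ∧ (D4) ∧ CAP+tail; G-an2-4 gates asym, D1 and NE2/3/4.»

WHAT ([folklore]; generic `d`, in-block root `ρ = toSite r`, `1 ≤ Lc`, any colour constant `cVH`, all units; 0 `def`, 0 cited facts, 0 `def … : Prop`, 0 sorry): §1 the five properties of
`S^VH κ v := cVH • vhSAt ρ d Lc rfl κ v` — `locStencil_vhS`, `vhS_inl_inl`, `vhS_translate`, `vhS_inr_fst_eq_zero`, `vhS_inr_snd_eq_zero`; §2 the six `S^VH` sector words of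
`DressedSourceZeroModeWords.zmode_dressedSource_inl_inl`'s two exchange words, `V^VH_{κ,u} = vertexOfK X̃♮_j Lc (unitS s_f s_m S^VH) κ u`, `V^E_{κ,u} = vertexOfK X̃♮_j Lc S^E κ u`:
**`sum_box_vh_wilson_latticeWilson_words_eq_zero`** (level `0`: `VH_c ⊗ E_{u′}` direct and `E_{u′} ⊗ VH_c` swap, per bond hence in the zero mode at any period — 24),
**`sum_box_vh_vh_words_eq_zero`** (every `j`: `VH ⊗ VH` direct and swap — 26), **`sum_box_wilson_vh_latticeVH_words_eq_zero`** (every `j`, zero mode at period `Lc`: `E_c ⊗ VH_{u′}` direct and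
`VH_{u′} ⊗ E_c` swap — 27).  Asserts NO value of Bałaban's tables beyond an1's ∕ an3's DEFINED tables; discharges NOTHING of (C)sym ∕ (Q-D) ∕ (Q-D-rate) ∕ «T2Shape» ∕ «T2Drift» ∕ (hW, hWall);
NEVER «G-an2-4 closed» as (CONV-C); NOT D1, NOT `BetaPertH`, NOT continuum, NOT Clay.  2026-08-23; no existing file touched.
-/

noncomputable section

open Finset
open scoped BigOperators
open Literature.MathematicalPhysics.QuantumFieldTheory
open Literature.MathematicalPhysics.QuantumFieldTheory.Balaban1983to89
open Literature.MathematicalPhysics.QuantumFieldTheory.Balaban1983to89.Beta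
open ExpKernelCalculus (Site MKer comp shiftK)
open OneStepResolventKernel (Fib LocStencil)
open OneStepKernelFamily (KInvStep vertexOfK)
open StepJetData (wilsonA locStencil_smul)
open AffineAveraging (box toSite)
open AveragingContours (off)
open AveragingHessianKernels (ell packVH packVH_inl_inr packVH_inr_inl packVH_inl_inl packVH_inr_inr)
open AveragingHessianKernelsRooted (vhSAt locStencil_vhSAt vhSAt_translate)
open Summit.QuantumFields.BalabanUV.Beta.AxialDressingRooted (coDressKBmAt)
open Summit.QuantumFields.BalabanUV.Beta.HessKerDressedUnits (unitK unitS)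
open Summit.QuantumFields.BalabanUV.Beta.GAN24.VHWordsZeroLattice (sum_box_noFF_wilson_words_eq_zero)
open Summit.QuantumFields.BalabanUV.Beta.GAN24.VHWordsZeroBorder (sum_box_border_border_words_eq_zero)
open Summit.QuantumFields.BalabanUV.Beta.GAN24.VHWordsZeroCell (sum_box_wilson_border_word_eq_zero sum_box_border_wilson_swap_word_eq_zero)

namespace Summit.QuantumFields.BalabanUV.Beta.GAN24.VHWordsZeroVhSAt

variable {d : ℕ} {Lc : ℕ} [NeZero Lc] {r : Fin (d + 1) → ℕ}

/-! ## §1 The five properties of `S^VH = cVH • vhSAt ρ` -/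

omit [NeZero Lc] in
/-- [folklore] `S^VH` is a local stencil family at every rate `δ ≥ 0` (`locStencil_vhSAt` ⨾ `locStencil_smul`). -/
theorem locStencil_vhS (hLc : 1 ≤ Lc) (hr : r ∈ box (d + 1) Lc) (cVH : ℝ) {δ : ℝ} (hδ : 0 ≤ δ) :
    LocStencil (fun κ v => cVH • vhSAt (toSite r) d Lc rfl κ v) (|cVH| * (3 * (ell (d + 1) Lc : ℝ) ^ 2 * Real.exp (4 * ((d : ℝ) + 1) * Lc * δ))) δ :=
  locStencil_smul cVH (locStencil_vhSAt hLc hr hδ)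

omit [NeZero Lc] in
/-- [folklore] `S^VH` has no field–field block (the packer `packVH` does not). -/
theorem vhS_inl_inl (cVH : ℝ) (κ' : Fin (d + 1)) (t x z : Site (d + 1)) (α' a : Fin (d + 1)) :
    (cVH • vhSAt (toSite r) d Lc rfl κ' t) x z (Sum.inl α') (Sum.inl a) = 0 := by
  simp only [Pi.smul_apply, smul_eq_mul]
  exact mul_eq_zero_of_right _ rfl

omit [NeZero Lc] in
/-- [folklore] `S^VH` is block-covariant (`vhSAt_translate`; the colour constant rides along). -/
theorem vhS_translate (hLc : 1 ≤ Lc) (cVH : ℝ) (κ : Fin (d + 1)) (u t : Site (d + 1)) :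
    (cVH • vhSAt (toSite r) d Lc rfl κ (u + (Lc : ℤ) • t)) = shiftK (-((Lc : ℤ) • t)) (cVH • vhSAt (toSite r) d Lc rfl κ u) := by
  rw [vhSAt_translate (toSite r) hLc κ u t]
  rfl

omit [NeZero Lc] in
/-- [folklore] The multiplier FIRST legs of `S^VH` sit on the coarse lattice (`packVH_inr_inl`'s `off L · = 0` guard; `packVH_inr_inr = 0`). -/
theorem vhS_inr_fst_eq_zero (cVH : ℝ) (κ : Fin (d + 1)) (t z w : Site (d + 1)) (m : Fin (d + 1)) (b : Fib d) (hz : off Lc z ≠ 0) :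
    (cVH • vhSAt (toSite r) d Lc rfl κ t) z w (Sum.inr m) b = 0 := by
  rcases b with b | b
  · simp only [Pi.smul_apply, smul_eq_mul, vhSAt, packVH_inr_inl, if_neg hz, mul_zero]
  · simp only [Pi.smul_apply, smul_eq_mul, vhSAt, packVH_inr_inr, mul_zero]

omit [NeZero Lc] in
/-- [folklore] The multiplier SECOND legs of `S^VH` sit on the coarse lattice (`packVH_inl_inr`'s guard; `packVH_inr_inr = 0`). -/
theorem vhS_inr_snd_eq_zero (cVH : ℝ) (κ : Fin (d + 1)) (t z w : Site (d + 1)) (a : Fib d) (m : Fin (d + 1)) (hw : off Lc w ≠ 0) :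
    (cVH • vhSAt (toSite r) d Lc rfl κ t) z w a (Sum.inr m) = 0 := by
  rcases a with a | a
  · simp only [Pi.smul_apply, smul_eq_mul, vhSAt, packVH_inl_inr, if_neg hw, mul_zero]
  · simp only [Pi.smul_apply, smul_eq_mul, vhSAt, packVH_inr_inr, mul_zero]

/-! ## §2 The six `S^VH` sector words of the dressed source's exchange words -/

variable {μ ν α β : Fin (d + 1)}

/-- [folklore] **LEVEL 0: the `VH_c ⊗ E_{u′}` direct word and the `E_{u′} ⊗ VH_c` swap word vanish bond by bond, hence in the zero mode at any period `N`** (24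
`VHWordsZeroLattice.sum_box_noFF_wilson_words_eq_zero` at `S′ = cVH • vhSAt ρ`). -/
theorem sum_box_vh_wilson_latticeWilson_words_eq_zero (hLc : 1 ≤ Lc) (hr : r ∈ box (d + 1) Lc) (sf sm cE cVH : ℝ) (N : ℕ) :
    (∑ c ∈ box (d + 1) N, ∑' u' : Site (d + 1), ∑' yw : Site (d + 1) × Site (d + 1), (if yw.1 α % (Lc : ℤ) = (Lc : ℤ) - 1 then (1 : ℝ) else 0) * (if yw.2 β % (Lc : ℤ) = (Lc : ℤ) - 1 then (1 : ℝ) else 0) *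
        comp (comp (vertexOfK (unitK sf sm (coDressKBmAt (toSite r) Lc (KInvStep (d := d) Lc 0))) Lc (unitS sf sm (fun κ v => cVH • vhSAt (toSite r) d Lc rfl κ v)) μ (toSite c))
          (unitK sf sm (coDressKBmAt (toSite r) Lc (KInvStep (d := d) Lc 0))))
          (vertexOfK (unitK sf sm (coDressKBmAt (toSite r) Lc (KInvStep (d := d) Lc 0))) Lc (unitS sf sm (fun κ v => cE • wilsonA d κ v)) ν u') yw.1 yw.2 (Sum.inl α) (Sum.inl β) = 0) ∧
    (∑ c ∈ box (d + 1) N, ∑' u' : Site (d + 1), ∑' yw : Site (d + 1) × Site (d + 1), (if yw.1 α % (Lc : ℤ) = (Lc : ℤ) - 1 then (1 : ℝ) else 0) * (if yw.2 β % (Lc : ℤ) = (Lc : ℤ) - 1 then (1 : ℝ) else 0) *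
        comp (comp (vertexOfK (unitK sf sm (coDressKBmAt (toSite r) Lc (KInvStep (d := d) Lc 0))) Lc (unitS sf sm (fun κ v => cE • wilsonA d κ v)) ν u')
          (unitK sf sm (coDressKBmAt (toSite r) Lc (KInvStep (d := d) Lc 0))))
          (vertexOfK (unitK sf sm (coDressKBmAt (toSite r) Lc (KInvStep (d := d) Lc 0))) Lc (unitS sf sm (fun κ v => cVH • vhSAt (toSite r) d Lc rfl κ v)) μ (toSite c)) yw.1 yw.2 (Sum.inl α) (Sum.inl β) = 0) :=
  sum_box_noFF_wilson_words_eq_zero (μ := μ) (ν := ν) (α := α) (β := β) hLc hr sf sm cE (locStencil_vhS hLc hr cVH zero_le_one) one_pos (vhS_inl_inl (r := r) cVH) N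

/-- [folklore] **EVERY LEVEL: the `VH ⊗ VH` direct and swap words vanish bond by bond, hence in the zero mode at any period `N`** (26 `VHWordsZeroBorder.sum_box_border_border_words_eq_zero`,
`Lc`-periodic exit-face weights). -/
theorem sum_box_vh_vh_words_eq_zero (hLc : 1 ≤ Lc) (hr : r ∈ box (d + 1) Lc) (sf sm cVH : ℝ) (j N : ℕ) :
    (∑ c ∈ box (d + 1) N, ∑' u' : Site (d + 1), ∑' yw : Site (d + 1) × Site (d + 1), (if yw.1 α % (Lc : ℤ) = (Lc : ℤ) - 1 then (1 : ℝ) else 0) * (if yw.2 β % (Lc : ℤ) = (Lc : ℤ) - 1 then (1 : ℝ) else 0) *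
        comp (comp (vertexOfK (unitK sf sm (coDressKBmAt (toSite r) Lc (KInvStep (d := d) Lc j))) Lc (unitS sf sm (fun κ v => cVH • vhSAt (toSite r) d Lc rfl κ v)) μ (toSite c))
          (unitK sf sm (coDressKBmAt (toSite r) Lc (KInvStep (d := d) Lc j))))
          (vertexOfK (unitK sf sm (coDressKBmAt (toSite r) Lc (KInvStep (d := d) Lc j))) Lc (unitS sf sm (fun κ v => cVH • vhSAt (toSite r) d Lc rfl κ v)) ν u') yw.1 yw.2 (Sum.inl α) (Sum.inl β) = 0) ∧
    (∑ c ∈ box (d + 1) N, ∑' u' : Site (d + 1), ∑' yw : Site (d + 1) × Site (d + 1), (if yw.1 α % (Lc : ℤ) = (Lc : ℤ) - 1 then (1 : ℝ) else 0) * (if yw.2 β % (Lc : ℤ) = (Lc : ℤ) - 1 then (1 : ℝ) else 0) *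
        comp (comp (vertexOfK (unitK sf sm (coDressKBmAt (toSite r) Lc (KInvStep (d := d) Lc j))) Lc (unitS sf sm (fun κ v => cVH • vhSAt (toSite r) d Lc rfl κ v)) ν u')
          (unitK sf sm (coDressKBmAt (toSite r) Lc (KInvStep (d := d) Lc j))))
          (vertexOfK (unitK sf sm (coDressKBmAt (toSite r) Lc (KInvStep (d := d) Lc j))) Lc (unitS sf sm (fun κ v => cVH • vhSAt (toSite r) d Lc rfl κ v)) μ (toSite c)) yw.1 yw.2 (Sum.inl α) (Sum.inl β) = 0) :=
  sum_box_border_border_words_eq_zero (μ := μ) (ν := ν) (α := α) (β := β)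
    (ρ₁ := fun y : Site (d + 1) => (if y α % (Lc : ℤ) = (Lc : ℤ) - 1 then (1 : ℝ) else 0))
    (ρ₂ := fun w : Site (d + 1) => (if w β % (Lc : ℤ) = (Lc : ℤ) - 1 then (1 : ℝ) else 0))
    hLc hr sf sm j (locStencil_vhS hLc hr cVH zero_le_one) one_pos (vhS_inl_inl (r := r) cVH)
    (vhS_translate (r := r) hLc cVH) (vhS_inr_fst_eq_zero (r := r) cVH) (vhS_inr_snd_eq_zero (r := r) cVH)
    (fun y => by split_ifs <;> simp) (fun w => by split_ifs <;> simp)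
    (fun y s => ExchangeSlotResum.face_weight_periodic Lc α y s) (fun w s => ExchangeSlotResum.face_weight_periodic Lc β w s) N

/-- [folklore] **EVERY LEVEL, ZERO MODE AT PERIOD `Lc`: the `E_c ⊗ VH_{u′}` direct word and the `VH_{u′} ⊗ E_c` swap word vanish** (27 `VHWordsZeroCell.sum_box_wilson_border_word_eq_zero ∕
sum_box_border_wilson_swap_word_eq_zero`). -/
theorem sum_box_wilson_vh_latticeVH_words_eq_zero (hLc : 1 ≤ Lc) (hr : r ∈ box (d + 1) Lc) (sf sm cE cVH : ℝ) (j : ℕ) :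
    (∑ c ∈ box (d + 1) Lc, ∑' u' : Site (d + 1), ∑' yw : Site (d + 1) × Site (d + 1), (if yw.1 α % (Lc : ℤ) = (Lc : ℤ) - 1 then (1 : ℝ) else 0) * (if yw.2 β % (Lc : ℤ) = (Lc : ℤ) - 1 then (1 : ℝ) else 0) *
        comp (comp (vertexOfK (unitK sf sm (coDressKBmAt (toSite r) Lc (KInvStep (d := d) Lc j))) Lc (unitS sf sm (fun κ v => cE • wilsonA d κ v)) μ (toSite c))
          (unitK sf sm (coDressKBmAt (toSite r) Lc (KInvStep (d := d) Lc j))))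
          (vertexOfK (unitK sf sm (coDressKBmAt (toSite r) Lc (KInvStep (d := d) Lc j))) Lc (unitS sf sm (fun κ v => cVH • vhSAt (toSite r) d Lc rfl κ v)) ν u') yw.1 yw.2 (Sum.inl α) (Sum.inl β) = 0) ∧
    (∑ c ∈ box (d + 1) Lc, ∑' u' : Site (d + 1), ∑' yw : Site (d + 1) × Site (d + 1), (if yw.1 α % (Lc : ℤ) = (Lc : ℤ) - 1 then (1 : ℝ) else 0) * (if yw.2 β % (Lc : ℤ) = (Lc : ℤ) - 1 then (1 : ℝ) else 0) *
        comp (comp (vertexOfK (unitK sf sm (coDressKBmAt (toSite r) Lc (KInvStep (d := d) Lc j))) Lc (unitS sf sm (fun κ v => cVH • vhSAt (toSite r) d Lc rfl κ v)) ν u')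
          (unitK sf sm (coDressKBmAt (toSite r) Lc (KInvStep (d := d) Lc j))))
          (vertexOfK (unitK sf sm (coDressKBmAt (toSite r) Lc (KInvStep (d := d) Lc j))) Lc (unitS sf sm (fun κ v => cE • wilsonA d κ v)) μ (toSite c)) yw.1 yw.2 (Sum.inl α) (Sum.inl β) = 0) :=
  ⟨sum_box_wilson_border_word_eq_zero (μ := μ) (ν := ν) (α := α) (β := β) hLc hr sf sm cE j (locStencil_vhS hLc hr cVH zero_le_one) one_pos (vhS_inl_inl (r := r) cVH)
      (vhS_translate (r := r) hLc cVH) (vhS_inr_fst_eq_zero (r := r) cVH),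
    sum_box_border_wilson_swap_word_eq_zero (μ := μ) (ν := ν) (α := α) (β := β) hLc hr sf sm cE j (locStencil_vhS hLc hr cVH zero_le_one) one_pos (vhS_inl_inl (r := r) cVH)
      (vhS_translate (r := r) hLc cVH) (vhS_inr_snd_eq_zero (r := r) cVH)⟩

end Summit.QuantumFields.BalabanUV.Beta.GAN24.VHWordsZeroVhSAt

end
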